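import Literature.GroupTheory.LocallyConstantCocyclesClosedSubgroups
import Literature.GroupTheory.ProfiniteOrbitClosure
import HarnessLib

/-!
# Neukirch's characterisation of decomposition groups, abstract core I: uniqueness

Topic `NumberTheory/GaloisRepresentations`; namespace
`Literature.NumberTheory.GaloisRepresentations.NeukirchAbstract`.  Proof file: theorems only (no
definition, no instance, no named fact).

This is the first of the abstract files isolating the GROUP-THEORETIC SKELETON of Neukirch's proof
that a closed subgroup "of local type" of `Γ_K = Gal(K̄/K)`, `K` a number field, lies in a
decomposition group ([Neukirch1969]; [NeukirchSchmidtWingberg2008] XII §1, (12.1.9)).  The number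
theory is abstracted into explicitly bound hypotheses on ONE ambient profinite group `Γ` acting on a
set `P` ("the primes of `K̄`", stabilisers `D p` = decomposition groups), with `ℓ`-torsion classes
modelled by locally constant `2`-cocycles `Γ → Γ → R` (`R` a field, e.g. `ZMod ℓ`) on subgroups, as
in `LocallyConstantCocyclesClosedSubgroups.lean`; the coboundary predicate is passed as a bound
variable `Cob` with its defining equivalence `hCob`, to keep statements readable.  Hypotheses of
"local-global" type used here:

* (AxD) local dimension `≤ 1`: on `D p ∩ V` (`V` open, small) any class is a multiple of a non-zero
  one — for `Γ_K` this is `|H²(K_w, μ_ℓ)| = ℓ` (Serre, *Corps locaux* XIII §3; the tree's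
  `TateLocalH2Pigeonhole`);
* (AxG) two-place existence: for primes `p₁, p₂` in different `V`-orbits there is a class on `V`
  non-zero at `p₁` and zero at `p₂` — for `Γ_K`: `δ` of a finite-order character with prescribed
  components (the tree's `CharacterPrescribedLocalComponents`, Clozel–Harris–Taylor Lemma 4.1.1).

Results:
* `not_coboundary_of_local_nonvanishing` — a global class on `V'` that is locally a non-zero multiple
  of a class surviving at every open level above the closed subgroup `H'` cannot die on `H'`
  (colim injectivity + (AxD));
* `exists_mem_smul_eq_of_local_nonvanishing` — **UNIQUENESS**: if `H'` is of local type
  (`H²(H') ≠ 0` of dimension `≤ 1`) and two primes `p₁, p₂` each carry a local class surviving at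
  every open level above `H'`, then `p₂ ∈ H' • p₁` — the abstract form of "there is exactly ONE prime
  of `L = K̄^{H'}` with non-vanishing local `H²(·, μ_ℓ)`" in the proof of [NSW] (12.1.9).

HONEST FRAMING: classical group cohomology (our kernel check); written for the abc-iut cell's
GAP-LEDGER row G-L4d2g4-1 (campaign L); nothing here bears on [IUTchIII] Cor. 3.12.

## References

* J. Neukirch, *Kennzeichnung der p-adischen und der endlichen algebraischen Zahlkörper*, Invent.
  Math. 6 (1969) 296–314. [Neukirch1969]
* J. Neukirch, A. Schmidt, K. Wingberg, *Cohomology of Number Fields* (2nd ed. 2008), XII §1,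
  Prop. (12.1.9). [NeukirchSchmidtWingberg2008]
-/

open Topology
open scoped Pointwise

universe u v w

namespace Literature.NumberTheory.GaloisRepresentations.NeukirchAbstract

open Literature.GroupTheory.LocallyConstantCocycles

variable {Γ : Type u} [Group Γ] [TopologicalSpace Γ]
variable {R : Type v} [Field R]

/-! ### More cochain algebra (restriction, linear combinations) -/

section Algebra

omit [Field R] in
/-- Local constancy of a `2`-cochain restricts to smaller subgroups (restriction of cochains, Serre
I §2.2). [cite: SerreGaloisCohomology1997, I §2.2] -/
theorem lc₂_mono {S T : Subgroup Γ} (hTS : T ≤ S) {f : Γ → Γ → R}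
    (h : IsLocallyConstant (fun p : S × S => f p.1 p.2)) :
    IsLocallyConstant (fun p : T × T => f p.1 p.2) :=
  have hc : Continuous (Subgroup.inclusion hTS) := Continuous.subtype_mk continuous_subtype_val _
  h.comp_continuous (f := fun p : T × T => (Subgroup.inclusion hTS p.1, Subgroup.inclusion hTS p.2))
    ((hc.comp continuous_fst).prodMk (hc.comp continuous_snd))

omit [TopologicalSpace Γ] in
/-- The cocycle identity restricts to smaller subgroups (Serre I §2.2). [cite: SerreGaloisCohomology1997, I §2.2] -/
theorem coc_mono {S T : Subgroup Γ} (hTS : T ≤ S) {f : Γ → Γ → R}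
    (h : ∀ a ∈ S, ∀ b ∈ S, ∀ c ∈ S, f a b + f (a * b) c = f b c + f a (b * c)) :
    ∀ a ∈ T, ∀ b ∈ T, ∀ c ∈ T, f a b + f (a * b) c = f b c + f a (b * c) :=
  fun a ha b hb c hc => h a (hTS ha) b (hTS hb) c (hTS hc)

/-- Linear combinations of locally constant `2`-cochains are locally constant (Serre I §2.2).
[cite: SerreGaloisCohomology1997, I §2.2] -/
theorem lc₂_lin {S : Subgroup Γ} (c₁ c₂ : R) {f g : Γ → Γ → R}
    (hf : IsLocallyConstant (fun p : S × S => f p.1 p.2))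
    (hg : IsLocallyConstant (fun p : S × S => g p.1 p.2)) :
    IsLocallyConstant (fun p : S × S => c₁ * f p.1 p.2 + c₂ * g p.1 p.2) :=
  hf.comp₂ hg (fun x y => c₁ * x + c₂ * y)

omit [TopologicalSpace Γ] in
/-- Linear combinations of `2`-cocycles are `2`-cocycles (Serre I §2.2). [cite: SerreGaloisCohomology1997, I §2.2] -/
theorem coc_lin {S : Subgroup Γ} (c₁ c₂ : R) {f g : Γ → Γ → R}
    (hf : ∀ a ∈ S, ∀ b ∈ S, ∀ c ∈ S, f a b + f (a * b) c = f b c + f a (b * c))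
    (hg : ∀ a ∈ S, ∀ b ∈ S, ∀ c ∈ S, g a b + g (a * b) c = g b c + g a (b * c)) :
    ∀ a ∈ S, ∀ b ∈ S, ∀ c ∈ S,
      (c₁ * f a b + c₂ * g a b) + (c₁ * f (a * b) c + c₂ * g (a * b) c) =
        (c₁ * f b c + c₂ * g b c) + (c₁ * f a (b * c) + c₂ * g a (b * c)) := by
  intro a ha b hb c hc
  linear_combination c₁ * hf a ha b hb c hc + c₂ * hg a ha b hb c hc

/-- Coboundaries are stable under pointwise equality on `S` (Serre I §2.2). [cite: SerreGaloisCohomology1997, I §2.2] -/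
theorem coboundary_congr {S : Subgroup Γ} {f g : Γ → Γ → R} (hfg : ∀ a ∈ S, ∀ b ∈ S, f a b = g a b)
    (h : ∃ β : Γ → R, IsLocallyConstant (fun s : S => β s) ∧
      ∀ a ∈ S, ∀ b ∈ S, f a b = β a + β b - β (a * b)) :
    ∃ β : Γ → R, IsLocallyConstant (fun s : S => β s) ∧
      ∀ a ∈ S, ∀ b ∈ S, g a b = β a + β b - β (a * b) := by
  obtain ⟨β, hβ, hf⟩ := h
  exact ⟨β, hβ, fun a ha b hb => (hfg a ha b hb).symm.trans (hf a ha b hb)⟩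

/-- Linear combinations of coboundaries are coboundaries (Serre I §2.2). [cite: SerreGaloisCohomology1997, I §2.2] -/
theorem coboundary_lin {S : Subgroup Γ} (c₁ c₂ : R) {f g : Γ → Γ → R}
    (hf : ∃ β : Γ → R, IsLocallyConstant (fun s : S => β s) ∧
      ∀ a ∈ S, ∀ b ∈ S, f a b = β a + β b - β (a * b))
    (hg : ∃ β : Γ → R, IsLocallyConstant (fun s : S => β s) ∧
      ∀ a ∈ S, ∀ b ∈ S, g a b = β a + β b - β (a * b)) :
    ∃ β : Γ → R, IsLocallyConstant (fun s : S => β s) ∧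
      ∀ a ∈ S, ∀ b ∈ S, c₁ * f a b + c₂ * g a b = β a + β b - β (a * b) :=
  coboundary_add (coboundary_smul c₁ hf) (coboundary_smul c₂ hg)

end Algebra

/-! ### The uniqueness step of [NSW] (12.1.9) -/

section Uniqueness

variable [IsTopologicalGroup Γ] [CompactSpace Γ] [TotallyDisconnectedSpace Γ]
variable (Cob : Subgroup Γ → (Γ → Γ → R) → Prop)
  (hCob : ∀ (S : Subgroup Γ) (f : Γ → Γ → R), Cob S f ↔
    ∃ β : Γ → R, IsLocallyConstant (fun s : S => β s) ∧ ∀ a ∈ S, ∀ b ∈ S, f a b = β a + β b - β (a * b))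

include hCob

/-- **A class that is locally a non-zero multiple of a surviving local class does not die on `H'`.**
Let `H' ≤ V'` be closed ≤ open subgroups of a profinite group, `D` a subgroup (a decomposition group),
assume local dimension `≤ 1` on `D ∩ V'` (hypothesis `hD` = (AxD)), and let `f` be a class on
`D ∩ V'` which stays non-zero on `D ∩ W` for every open `W` with `H' ≤ W ≤ V'`.  Then a class `z` on
`V'` with `z|_{D ∩ V'} ≠ 0` satisfies `z|_{H'} ≠ 0`: otherwise `z` dies on some open `W ⊇ H'`
(`exists_open_coboundary_of_coboundary`), while `z = c f ≠ 0` on `D ∩ W` with `c ≠ 0`.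
Abstract form of the comparison "`Br(M)[ℓ] → Br(M_w)[ℓ]`" in the proof of [NSW] Prop. (12.1.9).
[cite: NeukirchSchmidtWingberg2008, Prop (12.1.9)] -/
theorem not_coboundary_of_local_nonvanishing {H' V' D : Subgroup Γ} (hH' : IsClosed (H' : Set Γ))
    (hV' : IsOpen (V' : Set Γ)) (hH'V' : H' ≤ V')
    (hD : ∀ f g : Γ → Γ → R, IsLocallyConstant (fun p : ↥(D ⊓ V') × ↥(D ⊓ V') => f p.1 p.2) →
      (∀ a ∈ D ⊓ V', ∀ b ∈ D ⊓ V', ∀ c ∈ D ⊓ V', f a b + f (a * b) c = f b c + f a (b * c)) →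
      IsLocallyConstant (fun p : ↥(D ⊓ V') × ↥(D ⊓ V') => g p.1 p.2) →
      (∀ a ∈ D ⊓ V', ∀ b ∈ D ⊓ V', ∀ c ∈ D ⊓ V', g a b + g (a * b) c = g b c + g a (b * c)) →
      ¬ Cob (D ⊓ V') f → ∃ c : R, Cob (D ⊓ V') (fun a b => g a b - c * f a b))
    {f : Γ → Γ → R} (hflc : IsLocallyConstant (fun p : ↥(D ⊓ V') × ↥(D ⊓ V') => f p.1 p.2))
    (hfcoc : ∀ a ∈ D ⊓ V', ∀ b ∈ D ⊓ V', ∀ c ∈ D ⊓ V', f a b + f (a * b) c = f b c + f a (b * c))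
    (hf : ∀ W : Subgroup Γ, IsOpen (W : Set Γ) → H' ≤ W → W ≤ V' → ¬ Cob (D ⊓ W) f)
    {z : Γ → Γ → R} (hzlc : IsLocallyConstant (fun p : V' × V' => z p.1 p.2))
    (hzcoc : ∀ a ∈ V', ∀ b ∈ V', ∀ c ∈ V', z a b + z (a * b) c = z b c + z a (b * c))
    (hz : ¬ Cob (D ⊓ V') z) : ¬ Cob H' z := by
  intro hzH
  rw [hCob] at hzH
  obtain ⟨W, hW, hH'W, hWV', hzW⟩ := exists_open_coboundary_of_coboundary hH' hV' hH'V' hzlc hzH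
  -- `z = c • f` on `D ∩ V'` with `c ≠ 0`
  obtain ⟨c, hc⟩ := hD f z hflc hfcoc (lc₂_mono inf_le_right hzlc) (coc_mono inf_le_right hzcoc)
    (hf V' hV' hH'V' le_rfl)
  rw [hCob] at hc
  have hc0 : c ≠ 0 := by
    rintro rfl
    exact hz ((hCob _ _).2 (coboundary_congr (fun a _ b _ => by ring) hc))
  -- on `D ∩ W`: `z` and `z - c f` bound, hence `c f` bounds, hence `f` bounds
  have h1 : ∃ β : Γ → R, IsLocallyConstant (fun s : ↥(D ⊓ W) => β s) ∧
      ∀ a ∈ D ⊓ W, ∀ b ∈ D ⊓ W, z a b = β a + β b - β (a * b) :=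
    coboundary_mono inf_le_right hzW
  have h2 : ∃ β : Γ → R, IsLocallyConstant (fun s : ↥(D ⊓ W) => β s) ∧
      ∀ a ∈ D ⊓ W, ∀ b ∈ D ⊓ W, (z a b - c * f a b) = β a + β b - β (a * b) :=
    coboundary_mono (inf_le_inf_left D hWV') hc
  have h3 := coboundary_lin (S := D ⊓ W) (1 : R) (-1 : R) h1 h2
  have h4 : ∃ β : Γ → R, IsLocallyConstant (fun s : ↥(D ⊓ W) => β s) ∧
      ∀ a ∈ D ⊓ W, ∀ b ∈ D ⊓ W, c * f a b = β a + β b - β (a * b) :=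
    coboundary_congr (fun a _ b _ => by ring) h3
  exact hf W hW hH'W hWV' ((hCob _ _).2 (coboundary_of_smul_unit (isUnit_iff_ne_zero.2 hc0) h4))

/-- **UNIQUENESS step of Neukirch's theorem** ([NSW] Prop. (12.1.9), abstract form).  Let the profinite
group `Γ` act on `P` with closed stabilisers `D p`; assume local dimension `≤ 1` (AxD) and two-place
existence (AxG) at the open subgroups `V ≤ V₀`.  Let `H' ≤ Vt ≤ V₀` with `H'` closed of LOCAL TYPE
(`x ≠ 0` in `H²(H')`, every class on `H'` a multiple of `x`) and `Vt` open.  If two primes `p₁, p₂`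
each carry a local class (`fᵢ` on `D pᵢ ∩ Vt`) which survives on `D pᵢ ∩ W` for every open
`H' ≤ W ≤ Vt`, then `p₂ ∈ H' • p₁`.  (If `V • p₁ ∌ p₂` for some open `V ⊇ H'`, (AxG) gives classes
`z₁, z₂` on `V ∩ Vt` separating the two primes; by `not_coboundary_of_local_nonvanishing` both are
non-zero multiples `a x`, `b x` on `H'`, and `b z₁ - a z₂` dies on `H'` yet is non-zero at `p₁` —
contradiction; conclude by orbit closure.) [cite: NeukirchSchmidtWingberg2008, Prop (12.1.9)] -/
theorem exists_mem_smul_eq_of_local_nonvanishing {P : Type w} [MulAction Γ P]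
    (hst : ∀ p : P, IsClosed (MulAction.stabilizer Γ p : Set Γ)) {V₀ : Subgroup Γ}
    (AxD : ∀ V : Subgroup Γ, IsOpen (V : Set Γ) → V ≤ V₀ → ∀ (p : P) (f g : Γ → Γ → R),
      IsLocallyConstant (fun q : ↥(MulAction.stabilizer Γ p ⊓ V) × ↥(MulAction.stabilizer Γ p ⊓ V) =>
        f q.1 q.2) →
      (∀ a ∈ MulAction.stabilizer Γ p ⊓ V, ∀ b ∈ MulAction.stabilizer Γ p ⊓ V,
        ∀ c ∈ MulAction.stabilizer Γ p ⊓ V, f a b + f (a * b) c = f b c + f a (b * c)) →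
      IsLocallyConstant (fun q : ↥(MulAction.stabilizer Γ p ⊓ V) × ↥(MulAction.stabilizer Γ p ⊓ V) =>
        g q.1 q.2) →
      (∀ a ∈ MulAction.stabilizer Γ p ⊓ V, ∀ b ∈ MulAction.stabilizer Γ p ⊓ V,
        ∀ c ∈ MulAction.stabilizer Γ p ⊓ V, g a b + g (a * b) c = g b c + g a (b * c)) →
      ¬ Cob (MulAction.stabilizer Γ p ⊓ V) f →
        ∃ c : R, Cob (MulAction.stabilizer Γ p ⊓ V) (fun a b => g a b - c * f a b))
    (AxG : ∀ V : Subgroup Γ, IsOpen (V : Set Γ) → V ≤ V₀ → ∀ p₁ p₂ : P, (∀ v ∈ V, v • p₁ ≠ p₂) →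
      ∃ z : Γ → Γ → R, IsLocallyConstant (fun q : V × V => z q.1 q.2) ∧
        (∀ a ∈ V, ∀ b ∈ V, ∀ c ∈ V, z a b + z (a * b) c = z b c + z a (b * c)) ∧
        ¬ Cob (MulAction.stabilizer Γ p₁ ⊓ V) z ∧ Cob (MulAction.stabilizer Γ p₂ ⊓ V) z)
    {H' : Subgroup Γ} (hH' : IsClosed (H' : Set Γ)) {x : Γ → Γ → R}
    (hdim : ∀ g : Γ → Γ → R, IsLocallyConstant (fun q : H' × H' => g q.1 q.2) →
      (∀ a ∈ H', ∀ b ∈ H', ∀ c ∈ H', g a b + g (a * b) c = g b c + g a (b * c)) →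
      ∃ c : R, Cob H' (fun a b => g a b - c * x a b))
    {Vt : Subgroup Γ} (hVt : IsOpen (Vt : Set Γ)) (hH'Vt : H' ≤ Vt) (hVtV₀ : Vt ≤ V₀)
    {p₁ p₂ : P} {f₁ f₂ : Γ → Γ → R}
    (hf₁lc : IsLocallyConstant
      (fun q : ↥(MulAction.stabilizer Γ p₁ ⊓ Vt) × ↥(MulAction.stabilizer Γ p₁ ⊓ Vt) => f₁ q.1 q.2))
    (hf₁coc : ∀ a ∈ MulAction.stabilizer Γ p₁ ⊓ Vt, ∀ b ∈ MulAction.stabilizer Γ p₁ ⊓ Vt,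
      ∀ c ∈ MulAction.stabilizer Γ p₁ ⊓ Vt, f₁ a b + f₁ (a * b) c = f₁ b c + f₁ a (b * c))
    (hf₁ : ∀ W : Subgroup Γ, IsOpen (W : Set Γ) → H' ≤ W → W ≤ Vt →
      ¬ Cob (MulAction.stabilizer Γ p₁ ⊓ W) f₁)
    (hf₂lc : IsLocallyConstant
      (fun q : ↥(MulAction.stabilizer Γ p₂ ⊓ Vt) × ↥(MulAction.stabilizer Γ p₂ ⊓ Vt) => f₂ q.1 q.2))
    (hf₂coc : ∀ a ∈ MulAction.stabilizer Γ p₂ ⊓ Vt, ∀ b ∈ MulAction.stabilizer Γ p₂ ⊓ Vt,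
      ∀ c ∈ MulAction.stabilizer Γ p₂ ⊓ Vt, f₂ a b + f₂ (a * b) c = f₂ b c + f₂ a (b * c))
    (hf₂ : ∀ W : Subgroup Γ, IsOpen (W : Set Γ) → H' ≤ W → W ≤ Vt →
      ¬ Cob (MulAction.stabilizer Γ p₂ ⊓ W) f₂) :
    ∃ h ∈ H', h • p₁ = p₂ := by
  refine exists_mem_smul_eq_of_forall_open hst hH' fun V hV hH'V => ?_
  by_contra hne
  simp only [not_exists, not_and] at hne
  -- work at the open level `V' = V ⊓ Vt`
  set V' : Subgroup Γ := V ⊓ Vt with hV'def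
  have hV'o : IsOpen (V' : Set Γ) := hV.inter hVt
  have hH'V' : H' ≤ V' := le_inf hH'V hH'Vt
  have hV'Vt : V' ≤ Vt := inf_le_right
  have hV'V₀ : V' ≤ V₀ := hV'Vt.trans hVtV₀
  have hne₁ : ∀ v ∈ V', v • p₁ ≠ p₂ := fun v hv => hne v hv.1
  have hne₂ : ∀ v ∈ V', v • p₂ ≠ p₁ := by
    intro v hv h
    exact hne v⁻¹ (V'.inv_mem hv).1 (by rw [← h, inv_smul_smul])
  obtain ⟨z₁, hz₁lc, hz₁coc, hz₁p₁, hz₁p₂⟩ := AxG V' hV'o hV'V₀ p₁ p₂ hne₁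
  obtain ⟨z₂, hz₂lc, hz₂coc, hz₂p₂, hz₂p₁⟩ := AxG V' hV'o hV'V₀ p₂ p₁ hne₂
  -- the surviving local classes, seen at top level `V'`
  have hf₁' : ∀ W : Subgroup Γ, IsOpen (W : Set Γ) → H' ≤ W → W ≤ V' →
      ¬ Cob (MulAction.stabilizer Γ p₁ ⊓ W) f₁ := fun W hW h1 h2 => hf₁ W hW h1 (h2.trans hV'Vt)
  have hf₂' : ∀ W : Subgroup Γ, IsOpen (W : Set Γ) → H' ≤ W → W ≤ V' →
      ¬ Cob (MulAction.stabilizer Γ p₂ ⊓ W) f₂ := fun W hW h1 h2 => hf₂ W hW h1 (h2.trans hV'Vt)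
  have hz₁H : ¬ Cob H' z₁ :=
    not_coboundary_of_local_nonvanishing Cob hCob hH' hV'o hH'V' (AxD V' hV'o hV'V₀ p₁)
      (lc₂_mono (inf_le_inf_left _ hV'Vt) hf₁lc) (coc_mono (inf_le_inf_left _ hV'Vt) hf₁coc)
      hf₁' hz₁lc hz₁coc hz₁p₁
  have hz₂H : ¬ Cob H' z₂ :=
    not_coboundary_of_local_nonvanishing Cob hCob hH' hV'o hH'V' (AxD V' hV'o hV'V₀ p₂)
      (lc₂_mono (inf_le_inf_left _ hV'Vt) hf₂lc) (coc_mono (inf_le_inf_left _ hV'Vt) hf₂coc)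
      hf₂' hz₂lc hz₂coc hz₂p₂
  -- `zᵢ = cᵢ x` on `H'` with `cᵢ ≠ 0`
  obtain ⟨a, ha⟩ := hdim z₁ (lc₂_mono hH'V' hz₁lc) (coc_mono hH'V' hz₁coc)
  obtain ⟨b, hb⟩ := hdim z₂ (lc₂_mono hH'V' hz₂lc) (coc_mono hH'V' hz₂coc)
  rw [hCob] at ha hb
  have ha0 : a ≠ 0 := by
    rintro rfl
    exact hz₁H ((hCob _ _).2 (coboundary_congr (fun a _ b _ => by ring) ha))
  have hb0 : b ≠ 0 := by
    rintro rfl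
    exact hz₂H ((hCob _ _).2 (coboundary_congr (fun a _ b _ => by ring) hb))
  -- `w = b z₁ - a z₂` dies on `H'` …
  set w : Γ → Γ → R := fun s t => b * z₁ s t + (-a) * z₂ s t with hwdef
  have hwH : Cob H' w := by
    rw [hCob]
    exact coboundary_congr (fun s _ t _ => by simp only [hwdef]; ring) (coboundary_lin b (-a) ha hb)
  -- … is a locally constant cocycle on `V'` …
  have hwlc : IsLocallyConstant (fun q : V' × V' => w q.1 q.2) := lc₂_lin b (-a) hz₁lc hz₂lc
  have hwcoc : ∀ s ∈ V', ∀ t ∈ V', ∀ r ∈ V', w s t + w (s * t) r = w t r + w s (t * r) :=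
    coc_lin b (-a) hz₁coc hz₂coc
  -- … and does not die at `p₁`
  have hwp₁ : ¬ Cob (MulAction.stabilizer Γ p₁ ⊓ V') w := by
    intro hw
    rw [hCob] at hw hz₂p₁
    apply hz₁p₁
    rw [hCob]
    have h := coboundary_lin (S := MulAction.stabilizer Γ p₁ ⊓ V') (1 : R) a hw hz₂p₁
    have h' : ∃ β : Γ → R,
        IsLocallyConstant (fun s : ↥(MulAction.stabilizer Γ p₁ ⊓ V') => β s) ∧
        ∀ s ∈ MulAction.stabilizer Γ p₁ ⊓ V', ∀ t ∈ MulAction.stabilizer Γ p₁ ⊓ V',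
          b * z₁ s t = β s + β t - β (s * t) :=
      coboundary_congr (fun s _ t _ => by simp only [hwdef]; ring) h
    exact coboundary_of_smul_unit (isUnit_iff_ne_zero.2 hb0) h'
  exact not_coboundary_of_local_nonvanishing Cob hCob hH' hV'o hH'V' (AxD V' hV'o hV'V₀ p₁)
    (lc₂_mono (inf_le_inf_left _ hV'Vt) hf₁lc) (coc_mono (inf_le_inf_left _ hV'Vt) hf₁coc)
    hf₁' hwlc hwcoc hwp₁ hwH

end Uniqueness

end Literature.NumberTheory.GaloisRepresentations.NeukirchAbstract
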